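import Summits.AtomisticToContinuum.FouriersLaw.Theorems.BondHeatUncertaintyLinearResponseFTURPathLebesgueDuality
import Summits.AtomisticToContinuum.FouriersLaw.Theorems.BondHeatUncertaintyLinearResponseFTURFiniteBiasClausiusHelper1
import Summits.AtomisticToContinuum.FouriersLaw.Theorems.BondHeatUncertaintySubdiffusiveBondHeatBathBondReductionFlowLaws
import Summits.AtomisticToContinuum.FouriersLaw.Theorems.BondHeatUncertaintySubdiffusiveBondHeatKernelGibbsD

/-!
# Kernel detailed balance of the equal-temperature pinned chain from the anti-damped Girsanov formula

Helper file (pure proofs, no definitions) for the registered stub `stub_kernelDetailedBalance` of line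
`contact-current-forgetting`, crux stmt-AtomisticToContinuum-9127 (`JunctionLocality.NonBallistic`; the same text is
stub `stub_kernelDetailedBalance` of crux stmt-AtomisticToContinuum-9120, line `bath-bond-deficit-integral`):

  `∫ f · (P_s h) dμ_T = ∫ (h ∘ Θ) · P_s (f ∘ Θ) dμ_T`   (`f, h` measurable, `f², h² ∈ L¹(μ_T)`, `N ≥ 2`, `s ≥ 0`),

`Θ(q,p) = (q,-p)`, `P_s = transitionKernel N T T s` the constructed kernels of the pinned chain with both baths at
`T`, `μ_T = gibbsMeasure N T`. This file proves the REDUCTION of the stub to the anti-damped Girsanov formula K3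
(stub `stub_antiDampedGirsanov` of line `lebesgue-flip-duality`, crux stmt-AtomisticToContinuum-9122, not yet
landed), route (A) of `Cruxes/SubdiffusiveBondHeat/DetailedBalanceAnalysis.md`:

* `gibbsFlip_of_antiDampedGirsanov` — K1 (`stub_pathLebesgueDuality`, landed) + K3 (hypothesis, verbatim) give the
  heat-flux detailed balance `Θ̃_* R = e^{(Q_L+Q_R)/T} R` at `T_L = T_R = T` (slot bookkeeping of the landed lever
  `…LinearResponseFTURLineDefs.heatFluxDetailedBalance_of`); tested against `F = ρ_T(x_t) G(Θx_t, Θx_0)` and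
  combined with the PATHWISE energy balance `Q_L + Q_R = H(x_t) - H(x_0)` (`clausius_fwdPath_energy_balance`) and
  `ρ_T ∘ Θ = ρ_T`, it is the Gibbs-weighted two-endpoint flip identity
  `∫dz ρ_T(z) E[G(z, X_t^z)] = ∫dz ρ_T(z) E[G(ΘX_t^z, Θz)]` for every measurable `G ≥ 0` and `t > 0`;
* `gibbsFlip_zero` — the same identity at `t = 0` (Lebesgue measure and `ρ_T` are `Θ`-invariant);
* `compProd_map_flip_eq_of_gibbsFlip` — hence the two-time law `μ_T ⊗ₘ P_s` of `(x_0, x_s)` is invariant under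
  `(x, y) ↦ (Θy, Θx)` (one- and two-time laws of the constructed flow `…BathBondReductionTwoTime`, `…FlowLaws`,
  Gibbs invariance `pinnedChain_gibbsMeasure_bind_transitionKernel`, `gibbsMeasure_eq_smul_withDensity`);
* `detailedBalance_of_compProd_map_flip_eq` — and the weak `L²(μ_T)` form follows (`Measure.integral_compProd`,
  `pinnedChain_integrable_mul_compProd_of_invariant`, `integral_map`);
* `kernelDetailedBalance_of_antiDampedGirsanov` — the registered sub-goal: K3 (verbatim) → the stub (verbatim).
-/
noncomputable section

namespace Summit.AtomisticToContinuum.FouriersLaw.Theorems.NonBallistic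

open MeasureTheory ProbabilityTheory Set Filter Topology
open scoped NNReal ENNReal
open Literature.MathematicalPhysics.KineticTheory
open Literature.MathematicalPhysics.KineticTheory.HeatConduction
open Literature.Probability.Process
open Summit.AtomisticToContinuum.FouriersLaw.Theorems.BondHeatUncertainty
open Summit.AtomisticToContinuum.FouriersLaw.Theorems.SubdiffusiveBondHeat
open Summit.AtomisticToContinuum.FouriersLaw.Theorems.LinearResponseFTUR
open OscillatorChain

/-! ### Elementary facts -/

/-- The Gibbs density is even in the momenta (`H ∘ Θ = H`). -/
theorem gibbsDensity_neg_momentum (P : OscillatorChain) (N : ℕ) (T : ℝ) (x : PhaseSpace N) :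
    P.gibbsDensity N T (x.1, -x.2) = P.gibbsDensity N T x := by
  unfold OscillatorChain.gibbsDensity
  rw [OscillatorChain.hamiltonian_neg_momentum]

/-- **Gibbs product law through Lebesgue measure**: for the pinned chain (`ω₂ > 0`, `lam, β ≥ 0`, `T > 0`) and a
measurable `Φ ≥ 0` on `PhaseSpace N × WienerPair`,
`∫ Φ d(μ_T ⊗ W) = Z⁻¹ ∫dz ∫ ρ_T(z) Φ(z, w) W(dw)` (`gibbsMeasure_eq_smul_withDensity`, Tonelli). -/
theorem lintegral_gibbsMeasure_prod_wienerPair {ω₂ lam β : ℝ} (hω : 0 < ω₂) (hl : 0 ≤ lam) (hβ : 0 ≤ β)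
    (γ : ℝ) (N : ℕ) {T : ℝ} (hT : 0 < T) {Φ : PhaseSpace N × WienerPair → ℝ≥0∞} (hΦ : Measurable Φ) :
    ∫⁻ p, Φ p ∂(((pinnedChain ω₂ lam β γ).gibbsMeasure N T).prod wienerPair) =
      ((pinnedChain ω₂ lam β γ).partitionFunction N T)⁻¹ *
        ∫⁻ z, ∫⁻ w, ENNReal.ofReal ((pinnedChain ω₂ lam β γ).gibbsDensity N T z) * Φ (z, w) ∂wienerPair := by
  set P := pinnedChain ω₂ lam β γ with hP
  have hgi := pinnedChain_integrable_gibbsDensity hω hl hβ γ N hT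
  have hgc := pinnedChain_continuous_gibbsDensity ω₂ lam β γ N T
  have hgm : Measurable fun z => ENNReal.ofReal (P.gibbsDensity N T z) :=
    P.measurable_gibbsDensity_ofReal hgc
  rw [lintegral_prod _ hΦ.aemeasurable, P.gibbsMeasure_eq_smul_withDensity hgi,
    lintegral_smul_measure, lintegral_withDensity_eq_lintegral_mul _ hgm hΦ.lintegral_prod_right']
  congr 1
  refine lintegral_congr fun z => ?_
  exact (lintegral_const_mul _ (hΦ.comp measurable_prodMk_left)).symm

/-! ### K1 + K3 ⇒ the Gibbs-weighted two-endpoint flip identity -/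

/-- **K1 + K3 + energy balance ⇒ the Gibbs-weighted two-endpoint flip identity.** Assume the anti-damped Girsanov
formula K3 (the verbatim statement of stub `stub_antiDampedGirsanov` of line `lebesgue-flip-duality`, crux
stmt-AtomisticToContinuum-9122). Then for the pinned chain (all parameters positive), `N ≥ 2`, `T > 0`, `t > 0` and
every measurable `G ≥ 0` on `PhaseSpace N × PhaseSpace N`:
`∫dz ρ_T(z) E[G(z, X_t^z)] = ∫dz ρ_T(z) E[G(Θ X_t^z, Θ z)]`, `X_t^z = Φ_t(z, B)` the damped flow at equal
temperatures `T`. Proof: K1 (landed `stub_pathLebesgueDuality`) and K3 give the heat-flux detailed balance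
`∫dz E[F(Θ̃ obs)] = ∫dz E[e^{(Q_L+Q_R)/T} F(obs)]` exactly as in the landed lever `heatFluxDetailedBalance_of`;
test it against `F(obs) = ρ_T(x_t) G(Θx_t, Θx_0)` and use `Q_L + Q_R = H(x_t) - H(x_0)`
(`clausius_fwdPath_energy_balance`) and `ρ_T(Θx) = ρ_T(x)`. -/
theorem gibbsFlip_of_antiDampedGirsanov
    (hK3 : ∀ ω₂ lam β γ : ℝ, 0 < ω₂ → 0 < lam → 0 < β → 0 < γ →
      ∀ (N : ℕ) (i0 iN ib : Fin N), 2 ≤ N → i0.val = 0 → iN.val = N - 1 →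
      ∀ (T_L T_R : ℝ), 0 < T_L → 0 < T_R → ∀ t : ℝ, 0 ≤ t →
      ∀ (y : PhaseSpace N) (F : Obs N → ℝ≥0∞), Measurable F →
        ENNReal.ofReal (Real.exp (2 * γ * t)) *
            ∫⁻ w, F (swapObs N (flipObs N (rawObs (pinnedChain ω₂ lam β γ) N i0 iN ib t (y.1, -y.2)
              (revPath (pinnedChain ω₂ lam β γ) N T_L T_R (y.1, -y.2) w)))) ∂wienerPair =
          ∫⁻ w, ENNReal.ofReal (Real.exp
              (leftHeat i0 (rawObs (pinnedChain ω₂ lam β γ) N i0 iN ib t y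
                  (fwdPath (pinnedChain ω₂ lam β γ) N T_L T_R y w)) / T_L +
                rightHeat iN (rawObs (pinnedChain ω₂ lam β γ) N i0 iN ib t y
                  (fwdPath (pinnedChain ω₂ lam β γ) N T_L T_R y w)) / T_R)) *
            F (rawObs (pinnedChain ω₂ lam β γ) N i0 iN ib t y
              (fwdPath (pinnedChain ω₂ lam β γ) N T_L T_R y w)) ∂wienerPair)
    {ω₂ lam β γ : ℝ} (hω : 0 < ω₂) (hl : 0 < lam) (hβ : 0 < β) (hγ : 0 < γ) {N : ℕ} (hN : 1 < N)
    {T : ℝ} (hT : 0 < T) {t : ℝ} (ht : 0 < t) {G : PhaseSpace N × PhaseSpace N → ℝ≥0∞} (hG : Measurable G) :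
    ∫⁻ z, ∫⁻ w, ENNReal.ofReal ((pinnedChain ω₂ lam β γ).gibbsDensity N T z) *
        G (z, (pinnedChain ω₂ lam β γ).solMap N T T t z (pairPath w)) ∂wienerPair =
      ∫⁻ z, ∫⁻ w, ENNReal.ofReal ((pinnedChain ω₂ lam β γ).gibbsDensity N T z) *
        G ((((pinnedChain ω₂ lam β γ).solMap N T T t z (pairPath w)).1,
            -((pinnedChain ω₂ lam β γ).solMap N T T t z (pairPath w)).2), (z.1, -z.2)) ∂wienerPair := by
  set P := pinnedChain ω₂ lam β γ with hP
  have hN2 : 2 ≤ N := hN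
  set i0 : Fin N := ⟨0, by omega⟩ with hi0
  set iN : Fin N := ⟨N - 1, by omega⟩ with hiN
  -- K1 (landed) and K3 (hypothesis), specialised to equal temperatures and the bath sites `0`, `N - 1`
  have h1 := stub_pathLebesgueDuality ω₂ lam β γ hω hl hβ hγ N i0 iN i0 hN2 rfl rfl T T hT hT t ht
  have h3 := hK3 ω₂ lam β γ hω hl hβ hγ N i0 iN i0 hN2 rfl rfl T T hT hT t ht.le
  -- the heat-flux detailed balance at equal temperatures (slot bookkeeping of `heatFluxDetailedBalance_of`)
  have hGDB : ∀ F : Obs N → ℝ≥0∞, Measurable F →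
      ∫⁻ z, ∫⁻ w, F (flipObs N (rawObs P N i0 iN i0 t z (fwdPath P N T T z w))) ∂wienerPair =
        ∫⁻ z, ∫⁻ w, ENNReal.ofReal (Real.exp
            (leftHeat i0 (rawObs P N i0 iN i0 t z (fwdPath P N T T z w)) / T +
              rightHeat iN (rawObs P N i0 iN i0 t z (fwdPath P N T T z w)) / T)) *
          F (rawObs P N i0 iN i0 t z (fwdPath P N T T z w)) ∂wienerPair := by
    intro F hF
    have hF' : Measurable fun p : Obs N => F (flipObs N (swapObs N p)) :=
      hF.comp ((measurable_flipObs N).comp (measurable_swapObs N))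
    -- K1 applied to `F ∘ Θ̃ ∘ r` (`r ∘ r = id` definitionally on `rawObs`)
    have step1 :
        ∫⁻ z, ∫⁻ w, F (flipObs N (rawObs P N i0 iN i0 t z (fwdPath P N T T z w))) ∂wienerPair =
          ENNReal.ofReal (Real.exp (2 * γ * t)) *
            ∫⁻ y, ∫⁻ w, F (flipObs N (swapObs N
              (rawObs P N i0 iN i0 t y (revPath P N T T y w)))) ∂wienerPair :=
      h1 _ hF'
    -- K3 at the flipped starting point (`Θ̃ ∘ r = r ∘ Θ̃` definitionally)
    have step3 : ∀ y : PhaseSpace N,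
        ENNReal.ofReal (Real.exp (2 * γ * t)) *
            ∫⁻ w, F (flipObs N (swapObs N (rawObs P N i0 iN i0 t (momentumReversal N y)
              (revPath P N T T (momentumReversal N y) w)))) ∂wienerPair =
          ∫⁻ w, ENNReal.ofReal (Real.exp
              (leftHeat i0 (rawObs P N i0 iN i0 t y (fwdPath P N T T y w)) / T +
                rightHeat iN (rawObs P N i0 iN i0 t y (fwdPath P N T T y w)) / T)) *
            F (rawObs P N i0 iN i0 t y (fwdPath P N T T y w)) ∂wienerPair :=
      fun y => h3 y F hF
    rw [step1, ← lintegral_const_mul' _ _ ENNReal.ofReal_ne_top]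
    refine (MeasurePreserving.lintegral_map_equiv _ (momentumReversal N)
      (measurePreserving_momentumReversal N)).trans ?_
    exact lintegral_congr step3
  -- test function `F(obs) = ρ_T(x_t) G(Θ x_t, Θ x_0)`
  have hgc := pinnedChain_continuous_gibbsDensity ω₂ lam β γ N T
  have hρm : Measurable fun z => ENNReal.ofReal (P.gibbsDensity N T z) := P.measurable_gibbsDensity_ofReal hgc
  have hθ : Measurable fun o : Obs N => ((o.2.1.1, -o.2.1.2), (o.1.1, -o.1.2)) := by fun_prop
  have hF : Measurable fun o : Obs N =>
      ENNReal.ofReal (P.gibbsDensity N T o.2.1) * G ((o.2.1.1, -o.2.1.2), (o.1.1, -o.1.2)) :=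
    (hρm.comp (measurable_fst.comp measurable_snd)).mul (hG.comp hθ)
  have key := hGDB _ hF
  -- the two integrands, simplified
  have hlhs : ∀ (z : PhaseSpace N) (w : WienerPair),
      (fun o : Obs N => ENNReal.ofReal (P.gibbsDensity N T o.2.1) * G ((o.2.1.1, -o.2.1.2), (o.1.1, -o.1.2)))
          (flipObs N (rawObs P N i0 iN i0 t z (fwdPath P N T T z w))) =
        ENNReal.ofReal (P.gibbsDensity N T z) * G (z, P.solMap N T T t z (pairPath w)) := by
    intro z w
    simp only [flipObs, rawObs, fwdPath_apply, neg_neg, Prod.mk.eta, gibbsDensity_neg_momentum]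
  have hrhs : ∀ (z : PhaseSpace N) (w : WienerPair),
      ENNReal.ofReal (Real.exp
          (leftHeat i0 (rawObs P N i0 iN i0 t z (fwdPath P N T T z w)) / T +
            rightHeat iN (rawObs P N i0 iN i0 t z (fwdPath P N T T z w)) / T)) *
        (fun o : Obs N => ENNReal.ofReal (P.gibbsDensity N T o.2.1) * G ((o.2.1.1, -o.2.1.2), (o.1.1, -o.1.2)))
          (rawObs P N i0 iN i0 t z (fwdPath P N T T z w)) =
        ENNReal.ofReal (P.gibbsDensity N T z) *
          G (((P.solMap N T T t z (pairPath w)).1, -(P.solMap N T T t z (pairPath w)).2), (z.1, -z.2)) := by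
    intro z w
    have hb := clausius_fwdPath_energy_balance ω₂ lam β γ hω hl.le hβ.le hγ.le N i0 iN i0 hN2 rfl rfl T T t
      ht.le z w
    simp only [← mul_assoc]
    congr 1
    · rw [← ENNReal.ofReal_mul (Real.exp_pos _).le]
      congr 1
      show Real.exp _ * Real.exp (-P.hamiltonian N (fwdPath P N T T z w t) / T) =
        Real.exp (-P.hamiltonian N z / T)
      rw [← Real.exp_add]
      congr 1
      have hsum : leftHeat i0 (rawObs P N i0 iN i0 t z (fwdPath P N T T z w)) / T +
          rightHeat iN (rawObs P N i0 iN i0 t z (fwdPath P N T T z w)) / T =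
          (P.hamiltonian N (fwdPath P N T T z w t) - P.hamiltonian N z) / T := by
        rw [← add_div, hb]
      rw [hsum]
      ring
  have e1 := lintegral_congr (μ := (volume : Measure (PhaseSpace N))) fun z =>
    lintegral_congr (μ := wienerPair) fun w => hlhs z w
  have e2 := lintegral_congr (μ := (volume : Measure (PhaseSpace N))) fun z =>
    lintegral_congr (μ := wienerPair) fun w => hrhs z w
  rw [← e1, ← e2]
  exact key

/-- **The flip identity at time `0`**: `∫dz ρ_T(z) E[G(z, X_0^z)] = ∫dz ρ_T(z) E[G(ΘX_0^z, Θz)]` (`X_0^z = z`;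
Lebesgue measure and `ρ_T` are `Θ`-invariant). -/
theorem gibbsFlip_zero (ω₂ lam β γ : ℝ) (N : ℕ) (T : ℝ) (G : PhaseSpace N × PhaseSpace N → ℝ≥0∞) :
    ∫⁻ z, ∫⁻ w, ENNReal.ofReal ((pinnedChain ω₂ lam β γ).gibbsDensity N T z) *
        G (z, (pinnedChain ω₂ lam β γ).solMap N T T ((0 : ℝ≥0) : ℝ) z (pairPath w)) ∂wienerPair =
      ∫⁻ z, ∫⁻ w, ENNReal.ofReal ((pinnedChain ω₂ lam β γ).gibbsDensity N T z) *
        G ((((pinnedChain ω₂ lam β γ).solMap N T T ((0 : ℝ≥0) : ℝ) z (pairPath w)).1,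
            -((pinnedChain ω₂ lam β γ).solMap N T T ((0 : ℝ≥0) : ℝ) z (pairPath w)).2), (z.1, -z.2))
          ∂wienerPair := by
  set P := pinnedChain ω₂ lam β γ with hP
  have h0 : ∀ (z : PhaseSpace N) (w : WienerPair), P.solMap N T T ((0 : ℝ≥0) : ℝ) z (pairPath w) = z :=
    fun z w => pinnedChain_solMap_of_nonpos N T T z _ (by simp)
  simp only [h0, lintegral_const, measure_univ, mul_one]
  symm
  calc ∫⁻ z, ENNReal.ofReal (P.gibbsDensity N T z) * G ((z.1, -z.2), (z.1, -z.2))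
      = ∫⁻ z, (fun y : PhaseSpace N => ENNReal.ofReal (P.gibbsDensity N T (y.1, -y.2)) * G (y, y))
          (momentumReversal N z) := by
        refine lintegral_congr fun z => ?_
        simp only [momentumReversal_apply, neg_neg, Prod.mk.eta]
    _ = ∫⁻ y, ENNReal.ofReal (P.gibbsDensity N T (y.1, -y.2)) * G (y, y) :=
        (measurePreserving_momentumReversal N).lintegral_comp_emb (momentumReversal N).measurableEmbedding
          (fun y : PhaseSpace N => ENNReal.ofReal (P.gibbsDensity N T (y.1, -y.2)) * G (y, y))
    _ = ∫⁻ y, ENNReal.ofReal (P.gibbsDensity N T y) * G (y, y) := by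
        simp only [gibbsDensity_neg_momentum]

/-! ### From the flip identity to the invariance of the two-time law `μ_T ⊗ₘ P_s` -/

/-- **Invariance of the stationary two-time law under `(x, y) ↦ (Θy, Θx)`.** For the pinned chain (`ω₂ > 0`,
`lam, β, γ ≥ 0`, `N ≥ 1`, `T > 0`) and `s ≥ 0`: if the Gibbs-weighted two-endpoint flip identity holds at time `s`
for every measurable `G ≥ 0`, then `(μ_T ⊗ₘ P_s).map (fun (x, y) => (Θy, Θx)) = μ_T ⊗ₘ P_s`. Proof: `μ_T ⊗ₘ P_s` is
the law of `(z, X_s^z)` under `μ_T ⊗ W` (`pinnedChain_map_solMap_pair_of_invariant` at times `0, s`, Gibbs invariance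
at time `0`), and `μ_T ⊗ W`-integrals are `Z⁻¹ ∫dz ρ_T(z) ∫ W(dw)` (`lintegral_gibbsMeasure_prod_wienerPair`);
compare Lebesgue integrals of every measurable `G ≥ 0` (`Measure.ext_of_lintegral`). -/
theorem compProd_map_flip_eq_of_gibbsFlip {ω₂ lam β γ : ℝ} (hω : 0 < ω₂) (hl : 0 ≤ lam) (hβ : 0 ≤ β)
    (hγ : 0 ≤ γ) {N : ℕ} (hN : 0 < N) {T : ℝ} (hT : 0 < T) (s : ℝ≥0)
    (hflip : ∀ G : PhaseSpace N × PhaseSpace N → ℝ≥0∞, Measurable G →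
      ∫⁻ z, ∫⁻ w, ENNReal.ofReal ((pinnedChain ω₂ lam β γ).gibbsDensity N T z) *
          G (z, (pinnedChain ω₂ lam β γ).solMap N T T s z (pairPath w)) ∂wienerPair =
        ∫⁻ z, ∫⁻ w, ENNReal.ofReal ((pinnedChain ω₂ lam β γ).gibbsDensity N T z) *
          G ((((pinnedChain ω₂ lam β γ).solMap N T T s z (pairPath w)).1,
              -((pinnedChain ω₂ lam β γ).solMap N T T s z (pairPath w)).2), (z.1, -z.2)) ∂wienerPair) :
    (((pinnedChain ω₂ lam β γ).gibbsMeasure N T) ⊗ₘ ((pinnedChain ω₂ lam β γ).transitionKernel N T T s)).map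
        (fun q : PhaseSpace N × PhaseSpace N => ((q.2.1, -q.2.2), (q.1.1, -q.1.2))) =
      ((pinnedChain ω₂ lam β γ).gibbsMeasure N T) ⊗ₘ ((pinnedChain ω₂ lam β γ).transitionKernel N T T s) := by
  set P := pinnedChain ω₂ lam β γ with hP
  set μ := P.gibbsMeasure N T with hμ
  set κ := P.transitionKernel N T T s with hκ
  haveI : IsProbabilityMeasure μ := pinnedChain_isProbabilityMeasure_gibbsMeasure hω hl hβ γ N hT
  haveI : IsMarkovKernel κ := pinnedChain_isMarkovKernel_transitionKernel hω hl hβ hγ N T T s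
  have hϑ : Measurable fun q : PhaseSpace N × PhaseSpace N => ((q.2.1, -q.2.2), (q.1.1, -q.1.2)) := by
    fun_prop
  -- the two-time law of the flow started from `μ_T` at times `0` and `s`
  have hinv0 : μ.bind (P.transitionKernel N T T 0) = μ :=
    pinnedChain_gibbsMeasure_bind_transitionKernel hω hl hβ hγ hN hT 0
  have hlaw := pinnedChain_map_solMap_pair_of_invariant hω hl hβ hγ N T T μ 0 s hinv0
  have hjm : ∀ u : ℝ, Measurable fun p : PhaseSpace N × WienerPair => P.solMap N T T u p.1 (pairPath p.2) :=
    fun u => pinnedChain_measurable_solMap_pairPath hω hl hβ hγ N T T u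
  have hm : Measurable fun p : PhaseSpace N × WienerPair =>
      (P.solMap N T T ((0 : ℝ≥0) : ℝ) p.1 (pairPath p.2),
        P.solMap N T T ((0 + s : ℝ≥0) : ℝ) p.1 (pairPath p.2)) := (hjm _).prodMk (hjm _)
  have hpair : ∀ p : PhaseSpace N × WienerPair,
      (P.solMap N T T ((0 : ℝ≥0) : ℝ) p.1 (pairPath p.2), P.solMap N T T ((0 + s : ℝ≥0) : ℝ) p.1 (pairPath p.2)) =
        (p.1, P.solMap N T T s p.1 (pairPath p.2)) := by
    intro p
    rw [pinnedChain_solMap_of_nonpos N T T p.1 _ (by simp), zero_add]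
  -- every `μ_T ⊗ₘ P_s`-integral through the flow and Lebesgue measure
  have hrep : ∀ Φ : PhaseSpace N × PhaseSpace N → ℝ≥0∞, Measurable Φ →
      ∫⁻ q, Φ q ∂(μ ⊗ₘ κ) = (P.partitionFunction N T)⁻¹ *
        ∫⁻ z, ∫⁻ w, ENNReal.ofReal (P.gibbsDensity N T z) * Φ (z, P.solMap N T T s z (pairPath w))
          ∂wienerPair := by
    intro Φ hΦ
    rw [← hlaw, lintegral_map hΦ hm]
    simp only [hpair]
    exact lintegral_gibbsMeasure_prod_wienerPair hω hl hβ γ N hT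
      (hΦ.comp (measurable_fst.prodMk (hjm _)))
  refine Measure.ext_of_lintegral _ fun G hG => ?_
  have e1 : ∫⁻ q, G ((q.2.1, -q.2.2), (q.1.1, -q.1.2)) ∂(μ ⊗ₘ κ) = (P.partitionFunction N T)⁻¹ *
      ∫⁻ z, ∫⁻ w, ENNReal.ofReal (P.gibbsDensity N T z) *
        G (((P.solMap N T T s z (pairPath w)).1, -(P.solMap N T T s z (pairPath w)).2), (z.1, -z.2))
          ∂wienerPair :=
    hrep (fun q => G ((q.2.1, -q.2.2), (q.1.1, -q.1.2))) (hG.comp hϑ)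
  rw [lintegral_map hG hϑ, e1, hrep G hG, hflip G hG]

/-- **The weak `L²` detailed balance from the invariance of the two-time law.** For the pinned chain (`ω₂ > 0`,
`lam, β, γ ≥ 0`, `N ≥ 1`, `T > 0`), `s ≥ 0`: if `(μ_T ⊗ₘ P_s).map (fun (x,y) => (Θy, Θx)) = μ_T ⊗ₘ P_s`, then for
measurable `f, h` with `f², h² ∈ L¹(μ_T)`: `∫ f · (P_s h) dμ_T = ∫ (h∘Θ) · P_s(f∘Θ) dμ_T` (both sides are the
`μ_T ⊗ₘ P_s`-integral of the integrable `f ⊗ h`, resp. of `(f ⊗ h) ∘ (Θ-swap)`; `Measure.integral_compProd`). -/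
theorem detailedBalance_of_compProd_map_flip_eq {ω₂ lam β γ : ℝ} (hω : 0 < ω₂) (hl : 0 ≤ lam) (hβ : 0 ≤ β)
    (hγ : 0 ≤ γ) {N : ℕ} (hN : 0 < N) {T : ℝ} (hT : 0 < T) (s : ℝ≥0)
    (hmap : (((pinnedChain ω₂ lam β γ).gibbsMeasure N T) ⊗ₘ
        ((pinnedChain ω₂ lam β γ).transitionKernel N T T s)).map
          (fun q : PhaseSpace N × PhaseSpace N => ((q.2.1, -q.2.2), (q.1.1, -q.1.2))) =
      ((pinnedChain ω₂ lam β γ).gibbsMeasure N T) ⊗ₘ ((pinnedChain ω₂ lam β γ).transitionKernel N T T s))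
    {f h : PhaseSpace N → ℝ} (hf : Measurable f) (hh : Measurable h)
    (hf2 : Integrable (fun y => f y ^ 2) ((pinnedChain ω₂ lam β γ).gibbsMeasure N T))
    (hh2 : Integrable (fun y => h y ^ 2) ((pinnedChain ω₂ lam β γ).gibbsMeasure N T)) :
    ∫ y, f y * (∫ y', h y' ∂((pinnedChain ω₂ lam β γ).transitionKernel N T T s) y)
        ∂((pinnedChain ω₂ lam β γ).gibbsMeasure N T) =
      ∫ y, h (y.1, -y.2) * (∫ y', f (y'.1, -y'.2) ∂((pinnedChain ω₂ lam β γ).transitionKernel N T T s) y)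
        ∂((pinnedChain ω₂ lam β γ).gibbsMeasure N T) := by
  set P := pinnedChain ω₂ lam β γ with hP
  set μ := P.gibbsMeasure N T with hμ
  set κ := P.transitionKernel N T T s with hκ
  haveI : IsProbabilityMeasure μ := pinnedChain_isProbabilityMeasure_gibbsMeasure hω hl hβ γ N hT
  haveI : IsMarkovKernel κ := pinnedChain_isMarkovKernel_transitionKernel hω hl hβ hγ N T T s
  have hϑ : Measurable fun q : PhaseSpace N × PhaseSpace N => ((q.2.1, -q.2.2), (q.1.1, -q.1.2)) := by
    fun_prop
  have hinv : μ.bind κ = μ := pinnedChain_gibbsMeasure_bind_transitionKernel hω hl hβ hγ hN hT s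
  have hI : Integrable (fun q : PhaseSpace N × PhaseSpace N => f q.1 * h q.2) (μ ⊗ₘ κ) :=
    pinnedChain_integrable_mul_compProd_of_invariant hω hl hβ hγ N T T μ s hinv hf hh hf2 hh2
  have hI' : Integrable (fun q : PhaseSpace N × PhaseSpace N => f q.1 * h q.2)
      ((μ ⊗ₘ κ).map fun q : PhaseSpace N × PhaseSpace N => ((q.2.1, -q.2.2), (q.1.1, -q.1.2))) := by
    rw [hmap]; exact hI
  have hIc := (integrable_map_measure hI'.aestronglyMeasurable hϑ.aemeasurable).1 hI'
  have hI2 : Integrable (fun q : PhaseSpace N × PhaseSpace N => h (q.1.1, -q.1.2) * f (q.2.1, -q.2.2))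
      (μ ⊗ₘ κ) := by
    refine hIc.congr (Eventually.of_forall fun q => ?_)
    simp only [Function.comp_apply]
    ring
  have hL : ∫ y, f y * (∫ y', h y' ∂κ y) ∂μ = ∫ q, f q.1 * h q.2 ∂(μ ⊗ₘ κ) := by
    rw [Measure.integral_compProd hI]
    refine integral_congr_ae (Eventually.of_forall fun y => ?_)
    exact (integral_const_mul _ _).symm
  have hR : ∫ y, h (y.1, -y.2) * (∫ y', f (y'.1, -y'.2) ∂κ y) ∂μ =
      ∫ q, h (q.1.1, -q.1.2) * f (q.2.1, -q.2.2) ∂(μ ⊗ₘ κ) := by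
    rw [Measure.integral_compProd hI2]
    refine integral_congr_ae (Eventually.of_forall fun y => ?_)
    exact (integral_const_mul _ _).symm
  rw [hL, hR]
  calc ∫ q, f q.1 * h q.2 ∂(μ ⊗ₘ κ)
      = ∫ q, f q.1 * h q.2 ∂((μ ⊗ₘ κ).map
          fun q : PhaseSpace N × PhaseSpace N => ((q.2.1, -q.2.2), (q.1.1, -q.1.2))) := by rw [hmap]
    _ = ∫ q, ((fun q : PhaseSpace N × PhaseSpace N => f q.1 * h q.2) ∘
          fun q : PhaseSpace N × PhaseSpace N => ((q.2.1, -q.2.2), (q.1.1, -q.1.2))) q ∂(μ ⊗ₘ κ) :=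
        integral_map hϑ.aemeasurable hI'.aestronglyMeasurable
    _ = ∫ q, h (q.1.1, -q.1.2) * f (q.2.1, -q.2.2) ∂(μ ⊗ₘ κ) :=
        integral_congr_ae (Eventually.of_forall fun q => by simp only [Function.comp_apply]; ring)

/-! ### The registered sub-goal: K3 ⇒ kernel detailed balance -/

/-- **Kernel detailed balance from the anti-damped Girsanov formula** (registered sub-goal of stub
`stub_kernelDetailedBalance` of line `contact-current-forgetting`, crux stmt-AtomisticToContinuum-9127; the conclusion
is VERBATIM that stub, which is also stub `stub_kernelDetailedBalance` of crux stmt-AtomisticToContinuum-9120; the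
hypothesis is VERBATIM stub `stub_antiDampedGirsanov` (K3) of line `lebesgue-flip-duality`, crux
stmt-AtomisticToContinuum-9122). For the pinned chain with all parameters positive, `T > 0`, `N ≥ 2`, `s ≥ 0` and
measurable `f, h` with `f², h² ∈ L¹(μ_T)`:
`∫ f · (P_s h) dμ_T = ∫ (h ∘ Θ) · P_s (f ∘ Θ) dμ_T`. Proof: `gibbsFlip_of_antiDampedGirsanov` (`s > 0`) /
`gibbsFlip_zero` (`s = 0`), `compProd_map_flip_eq_of_gibbsFlip`, `detailedBalance_of_compProd_map_flip_eq`. -/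
theorem kernelDetailedBalance_of_antiDampedGirsanov :
    (∀ ω₂ lam β γ : ℝ, 0 < ω₂ → 0 < lam → 0 < β → 0 < γ →
      ∀ (N : ℕ) (i0 iN ib : Fin N), 2 ≤ N → i0.val = 0 → iN.val = N - 1 →
      ∀ (T_L T_R : ℝ), 0 < T_L → 0 < T_R → ∀ t : ℝ, 0 ≤ t →
      ∀ (y : PhaseSpace N) (F : Obs N → ℝ≥0∞), Measurable F →
        ENNReal.ofReal (Real.exp (2 * γ * t)) *
            ∫⁻ w, F (swapObs N (flipObs N (rawObs (pinnedChain ω₂ lam β γ) N i0 iN ib t (y.1, -y.2)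
              (revPath (pinnedChain ω₂ lam β γ) N T_L T_R (y.1, -y.2) w)))) ∂wienerPair =
          ∫⁻ w, ENNReal.ofReal (Real.exp
              (leftHeat i0 (rawObs (pinnedChain ω₂ lam β γ) N i0 iN ib t y
                  (fwdPath (pinnedChain ω₂ lam β γ) N T_L T_R y w)) / T_L +
                rightHeat iN (rawObs (pinnedChain ω₂ lam β γ) N i0 iN ib t y
                  (fwdPath (pinnedChain ω₂ lam β γ) N T_L T_R y w)) / T_R)) *
            F (rawObs (pinnedChain ω₂ lam β γ) N i0 iN ib t y
              (fwdPath (pinnedChain ω₂ lam β γ) N T_L T_R y w)) ∂wienerPair) →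
    ∀ ω₂ lam β γ : ℝ, 0 < ω₂ → 0 < lam → 0 < β → 0 < γ → ∀ T : ℝ, 0 < T → ∀ (N : ℕ) (hN : 1 < N),
      ∀ (s : NNReal) (f h : PhaseSpace N → ℝ), Measurable f → Measurable h →
        Integrable (fun y => f y ^ 2) ((pinnedChain ω₂ lam β γ).gibbsMeasure N T) →
        Integrable (fun y => h y ^ 2) ((pinnedChain ω₂ lam β γ).gibbsMeasure N T) →
        ∫ y, f y * (∫ y', h y' ∂((pinnedChain ω₂ lam β γ).transitionKernel N T T s) y)
            ∂((pinnedChain ω₂ lam β γ).gibbsMeasure N T) =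
          ∫ y, h (y.1, -y.2) * (∫ y', f (y'.1, -y'.2) ∂((pinnedChain ω₂ lam β γ).transitionKernel N T T s) y)
            ∂((pinnedChain ω₂ lam β γ).gibbsMeasure N T) := by
  intro hK3 ω₂ lam β γ hω hl hβ hγ T hT N hN s f h hf hh hf2 hh2
  have hN0 : 0 < N := by omega
  refine detailedBalance_of_compProd_map_flip_eq hω hl.le hβ.le hγ.le hN0 hT s ?_ hf hh hf2 hh2
  refine compProd_map_flip_eq_of_gibbsFlip hω hl.le hβ.le hγ.le hN0 hT s fun G hG => ?_
  rcases eq_or_lt_of_le s.2 with hs | hs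
  · -- `s = 0`
    have hs0 : s = 0 := by
      ext; exact hs.symm
    subst hs0
    exact gibbsFlip_zero ω₂ lam β γ N T G
  · exact gibbsFlip_of_antiDampedGirsanov hK3 hω hl hβ hγ hN hT hs hG

end Summit.AtomisticToContinuum.FouriersLaw.Theorems.NonBallistic

end
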